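import Mathlib
import Summits.CriticalPhenomena.CardyFormulaZ2.Theorems.CardyMagicRigidityNestingRigidityFirstMomentIdentity
import Literature.Probability.Percolation.InterfaceScalingLimitTriProofs
import HarnessLib

/-!
# Crux `NestingRigidity`, line `positive-cone-weight-doubling`: an EXPLICIT bound on the number of
# loops meeting a ball, both lattices (the microscopic loops of the collar statistic, helper K
# `uvCollar_expMoment_latticeEnsembles`)

Crux `Summit.CriticalPhenomena.CardyFormulaZ2.Theses.CardyMagicRigidity.NestingRigidity`
(stmt-CriticalPhenomena-4835), line `positive-cone-weight-doubling`, registered helper K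
`uvCollar_expMoment_latticeEnsembles`.  The collar statistic weighs a loop of diameter `d` crossing
a thin collar at radius `≍ ρ'` by `min(1, d²/ρ'²)`; loops of diameter below a fixed multiple of the
mesh (`d < C δ`) are out of reach of RSW, but there are at most `O((ρ'/δ)²)` loops meeting the ball
AT ALL, so they weigh `O((ρ'/δ)² · δ²/ρ'²) = O(1)` deterministically.  The tree's bound
`FirstMoment.exists_ncard_loops_meeting_le` is not explicit in `δ`; this file makes it explicit
(registered anchor `ncard_loops_meeting_le_latticeEnsembles`): for `E ∈ latticeEnsembles`, `δ > 0`,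
`R ≥ 0` and every sample, `#{u ∈ X_δ : trace u ∩ B̄(0, R) ≠ ∅} ≤ 32 (R/δ + 5)²` — on bond-`ℤ²` the
loops are drawn through corners of the box of half-width `⌈(R+δ)/δ⌉ + 2`
(`ncard_loops_meeting_le`, `corner_mem_pi_Icc`), on site-`𝕋` through faces of the box of
half-width `⌈2((R + 2δ)/δ + 2)⌉` (`ncard_loops_siteLoopConfig_meeting_le`,
`abs_sub_le_of_norm_hexCenter_sub_le`).  No cited fact, no definition.
-/

noncomputable section

open MeasureTheory Set Filter Metric
open scoped Real Topology BigOperators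

namespace Summit.CriticalPhenomena.CardyFormulaZ2.Cruxes.NestingRigidity.PositiveConeWeightDoubling

open Literature.Probability.RandomPlanarGeometry Literature.Probability.Percolation
  Literature.Probability.LatticeModels
open Summit.CriticalPhenomena.CardyFormulaZ2.Cruxes.NestingRigidity.RingCloudTomography

namespace UVCollar

/-! ## Counting corners and faces in a box -/

/-- **The corners of bond-`ℤ²` with source medial point of norm `≤ r` (`r ≥ 0`) number at most
`4 (2 ⌈r/δ⌉ + 5)²`**: their vertices lie in the box of half-width `⌈r/δ⌉ + 2` (`corner_mem_pi_Icc`). -/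
theorem card_corners_le {δ : ℝ} (hδ : 0 < δ) {r : ℝ} (hr : 0 ≤ r) :
    (finite_setOf_corner_norm_le hδ r).toFinset.card ≤ 4 * (2 * (⌈r / δ⌉.toNat + 2) + 1) ^ 2 := by
  classical
  set n : ℕ := ⌈r / δ⌉.toNat + 2 with hn
  have hK : (⌈r / δ⌉ + 2 : ℤ) = (n : ℤ) := by
    rw [hn]; push_cast; rw [Int.toNat_of_nonneg (Int.ceil_nonneg (div_nonneg hr hδ.le))]
  have hsub : (finite_setOf_corner_norm_le hδ r).toFinset ⊆ hexCellBox 0 n ×ˢ Finset.univ := by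
    intro p hp
    rw [Set.Finite.mem_toFinset] at hp
    obtain ⟨j, hj⟩ := exists_cSrc_eq_cornerEdge p
    have hp' : ‖medialPoint δ (cornerEdge p.1 (cFace p) j)‖ ≤ r := by rw [← hj]; exact hp
    have hbox := (corner_mem_pi_Icc hδ (isCorner_cFace p) hp').1
    refine Finset.mem_product.2 ⟨mem_hexCellBox.2 fun i ↦ ?_, Finset.mem_univ _⟩
    have hi := hbox i (Set.mem_univ _)
    rw [hK, Set.mem_Icc] at hi
    rw [Pi.zero_apply, sub_zero, abs_le]
    exact hi
  calc (finite_setOf_corner_norm_le hδ r).toFinset.card ≤ (hexCellBox 0 n ×ˢ (Finset.univ : Finset (Fin 4))).card :=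
        Finset.card_le_card hsub
    _ = 4 * (2 * n + 1) ^ 2 := by
        rw [Finset.card_product, card_hexCellBox, Finset.card_univ, Fintype.card_fin]; ring

/-- **The faces of `𝕋` with rescaled centre of norm `≤ ρ` number at most
`2 (2 ⌈2(ρ/δ + 2)⌉ + 1)²`**: their cells lie in the box of half-width `⌈2(ρ/δ + 2)⌉`
(`abs_sub_le_of_norm_hexCenter_sub_le`). -/
theorem card_faces_le {δ : ℝ} (hδ : 0 < δ) (ρ : ℝ) :
    (finite_setOf_norm_hexCenter_le hδ ρ).toFinset.card ≤ 2 * (2 * ⌈2 * (ρ / δ + 2)⌉₊ + 1) ^ 2 := by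
  classical
  set n : ℕ := ⌈2 * (ρ / δ + 2)⌉₊ with hn
  have hsub : (finite_setOf_norm_hexCenter_le hδ ρ).toFinset ⊆ hexCellBox 0 n ×ˢ Finset.univ := by
    intro F hF
    rw [Set.Finite.mem_toFinset] at hF
    have hF' : ‖hexCenter F - triEmbed 0‖ ≤ ρ / δ := by
      rw [triEmbed_zero, sub_zero, le_div_iff₀ hδ]
      have e : ‖(δ : ℂ) * hexCenter F‖ = ‖hexCenter F‖ * δ := by
        rw [norm_mul, Complex.norm_real, Real.norm_of_nonneg hδ.le, mul_comm]
      rw [← e]; exact hF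
    refine Finset.mem_product.2 ⟨mem_hexCellBox.2 fun i ↦ ?_, Finset.mem_univ _⟩
    exact abs_sub_le_of_norm_hexCenter_sub_le hF' (Nat.le_ceil _) i
  calc (finite_setOf_norm_hexCenter_le hδ ρ).toFinset.card
      ≤ (hexCellBox 0 n ×ˢ (Finset.univ : Finset (Fin 2))).card := Finset.card_le_card hsub
    _ = 2 * (2 * n + 1) ^ 2 := by
        rw [Finset.card_product, card_hexCellBox, Finset.card_univ, Fintype.card_fin]; ring

/-! ## The explicit count on each lattice -/

/-- **Bond-`ℤ²`: at most `32 (R/δ + 5)²` loops of `zEns.X δ ω` meet `B̄(0, R)`** (`δ > 0`, `R ≥ 0`,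
every configuration). -/
theorem ncard_loops_meeting_le_zEns {δ : ℝ} (hδ : 0 < δ) {R : ℝ} (hR : 0 ≤ R) (ω : zEns.Ω) :
    {u ∈ (zEns.X δ ω).loops | (u.range ∩ closedBall (0 : ℂ) R).Nonempty}.Finite ∧
      ({u ∈ (zEns.X δ ω).loops | (u.range ∩ closedBall (0 : ℂ) R).Nonempty}.ncard : ℝ) ≤
        32 * (R / δ + 5) ^ 2 := by
  obtain ⟨hfin, hle⟩ := ncard_loops_meeting_le hδ R ω
  refine ⟨hfin, ?_⟩
  have hr : 0 ≤ R + |δ| := by positivity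
  have h1 := hle.trans (card_corners_le hδ hr)
  have e : (R + |δ|) / δ = R / δ + 1 := by rw [abs_of_pos hδ, add_div, div_self hδ.ne']
  have h2 : ((⌈(R + |δ|) / δ⌉.toNat : ℤ) : ℝ) ≤ R / δ + 2 := by
    have hc : ((⌈(R + |δ|) / δ⌉.toNat : ℤ) : ℝ) = (⌈(R + |δ|) / δ⌉ : ℝ) := by
      rw [Int.toNat_of_nonneg (Int.ceil_nonneg (div_nonneg hr hδ.le))]
    rw [hc, e]
    have := Int.ceil_lt_add_one (R / δ + 1)
    linarith
  have h3 : (({u ∈ (zEns.X δ ω).loops | (u.range ∩ closedBall (0 : ℂ) R).Nonempty}.ncard : ℕ) : ℝ) ≤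
      4 * (2 * ((⌈(R + |δ|) / δ⌉.toNat : ℝ) + 2) + 1) ^ 2 := by exact_mod_cast h1
  have h4 : ((⌈(R + |δ|) / δ⌉.toNat : ℕ) : ℝ) ≤ R / δ + 2 := by exact_mod_cast h2
  have h5 : 0 ≤ R / δ := div_nonneg hR hδ.le
  nlinarith [h3, h4, Nat.cast_nonneg (α := ℝ) (⌈(R + |δ|) / δ⌉.toNat)]

/-- **Site-`𝕋`: at most `32 (R/δ + 5)²` loops of `tEns.X δ ω` meet `B̄(0, R)`** (`δ > 0`, `R ≥ 0`,
every configuration). -/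
theorem ncard_loops_meeting_le_tEns {δ : ℝ} (hδ : 0 < δ) {R : ℝ} (hR : 0 ≤ R) (ω : tEns.Ω) :
    {u ∈ (tEns.X δ ω).loops | (u.range ∩ closedBall (0 : ℂ) R).Nonempty}.Finite ∧
      ({u ∈ (tEns.X δ ω).loops | (u.range ∩ closedBall (0 : ℂ) R).Nonempty}.ncard : ℝ) ≤
        32 * (R / δ + 5) ^ 2 := by
  obtain ⟨hfin, hle⟩ := ncard_loops_siteLoopConfig_meeting_le hδ R ω
  refine ⟨hfin, ?_⟩
  have h1 := hle.trans (card_faces_le hδ (R + 2 * δ))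
  have e : 2 * ((R + 2 * δ) / δ + 2) = 2 * (R / δ) + 8 := by
    rw [add_div, mul_div_assoc, div_self hδ.ne']; ring
  have h2 : ((⌈2 * ((R + 2 * δ) / δ + 2)⌉₊ : ℕ) : ℝ) ≤ 2 * (R / δ) + 9 := by
    rw [e]
    have := Nat.ceil_lt_add_one (show 0 ≤ 2 * (R / δ) + 8 by positivity)
    linarith
  have h3 : (({u ∈ (tEns.X δ ω).loops | (u.range ∩ closedBall (0 : ℂ) R).Nonempty}.ncard : ℕ) : ℝ) ≤
      2 * (2 * ((⌈2 * ((R + 2 * δ) / δ + 2)⌉₊ : ℕ) : ℝ) + 1) ^ 2 := by exact_mod_cast h1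
  have h5 : 0 ≤ R / δ := div_nonneg hR hδ.le
  nlinarith [h3, h2, Nat.cast_nonneg (α := ℝ) ⌈2 * ((R + 2 * δ) / δ + 2)⌉₊]

end UVCollar

/-! ## Both lattice ensembles (registered anchor) -/

/-- **Anchor (helper toward K `uvCollar_expMoment_latticeEnsembles`): an explicit deterministic bound
on the number of loops meeting a ball, both lattices.**  For `E ∈ latticeEnsembles`, every mesh
`δ > 0`, radius `R ≥ 0` and EVERY sample, the loops of `X_δ` whose trace meets `B̄(0, R)` form a
finite set of cardinality `≤ 32 (R/δ + 5)²` (corners of a box on bond-`ℤ²`, faces of a box on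
site-`𝕋`): the microscopic loops of the collar statistic (diameter `< C δ`, weight `≤ C² δ²/ρ'²`
each) thus weigh `O(1)` in total, deterministically. -/
theorem ncard_loops_meeting_le_latticeEnsembles : ∀ E ∈ latticeEnsembles, ∀ (δ R : ℝ) (ω : E.Ω), 0 < δ → 0 ≤ R → {u ∈ (E.X δ ω).loops | (u.range ∩ Metric.closedBall (0 : ℂ) R).Nonempty}.Finite ∧ ({u ∈ (E.X δ ω).loops | (u.range ∩ Metric.closedBall (0 : ℂ) R).Nonempty}.ncard : ℝ) ≤ 32 * (R / δ + 5) ^ 2 := by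
  intro E hE δ R ω hδ hR
  simp only [latticeEnsembles, Set.mem_insert_iff, Set.mem_singleton_iff] at hE
  rcases hE with rfl | rfl
  · exact UVCollar.ncard_loops_meeting_le_zEns hδ hR ω
  · exact UVCollar.ncard_loops_meeting_le_tEns hδ hR ω

end Summit.CriticalPhenomena.CardyFormulaZ2.Cruxes.NestingRigidity.PositiveConeWeightDoubling

end
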